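import Mathlib
import HarnessLib
import Summits.Ventures.LatticeQCDFlow.Scaling.TorusPlaquetteLastLinks
import Summits.Ventures.LatticeQCDFlow.Scaling.AutoregressiveGaugePlaquetteMarginal
import Summits.Ventures.LatticeQCDFlow.Scaling.AutoregressiveProposalKLStepFloor
import Summits.Ventures.LatticeQCDFlow.Scaling.AutoregressiveProposalSlowingDown
import Summits.Ventures.LatticeQCDFlow.Scaling.AutoregressiveGaugeKLExtensiveStepFloor

/-!
# LatticeQCDFlow / Scaling — THE VOLUME LAW FROM ANY PER-LINK DIVERGENCE FLOOR: in every generation order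
# of all links, an autoregressive gauge model whose conditional divergence at a link generated after the
# other three links of a plaquette is at least `m` has training loss `≥ (d·#sites/4)·m` and drives an exact
# sampler with `τ_int(sign) ≥ exp((d·#sites/4)·m) − ½` and `1/κ ≥ exp((d·#sites/4)·m)`

HONEST FRAMING: exact (Metropolis-corrected) sampling algorithms for lattice gauge theory;
figures of merit are autocorrelation/cost numbers at stated couplings and volumes; no
continuum-physics claim.

Venture `LatticeQCDFlow` (cell pub-lqcd), topic `Scaling`, FANOUT row 30 (lean-1, GEN-21) — OUR WORK on
THEORY-2.md §4 row C5: the twin of `Scaling/AutoregressiveGaugeKLExtensiveStepFloor` for the DIVERGENCE route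
(no Pinsker).  Assembles `Scaling/AutoregressiveProposalKLStepFloor.kl_arHybrid_ge_card_mul_of_stepKL`
(`#T·m ≤ KL` when `#T` steps have mean conditional divergence `≥ m`: the KL chain rule),
`Scaling/TorusPlaquetteLastLinks` (every order of all links closes `≥ d·#sites/4` plaquettes at distinct
links) and `Scaling/AutoregressiveProposalSlowingDown` (`e^{KL} − ½ ≤ τ_int(sign)`, `e^{KL} ≤ 1/κ`).  The
floor hypothesis: for every plaquette `p`, every link `e` of `p` and every set `s` of links OFF `p` that
`q_e` does not read, `m·Z ≤ ∫ F·log(A_sF/(q_e·A_{insert e s}F)) dπ`.  Instance (separate file): the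
logarithmic floor `m = π_β{U_p ∈ B}·log(1/Haar B) − log 2` of `Scaling/AutoregressiveGaugeStepKLLogFloor`
for conditioners blind at one endpoint — unbounded at weak coupling.

## What is proved (all [ours]; Wilson weight `F = e^{−βS_W}` of a continuous `ρ`, any real `β`, any
compact `G`, any `L`; `q_a` measurable, squeezed `0 < c_q ≤ q_a ≤ C_q`, normalised in `a`, not reading
the links after `a` in the duplicate-free order `l`; `H_l = (∏ q_a)·A_lF/Z`; `m ≥ 0`)

* §1 **`wilson_kl_arHybrid_ge_card_mul_of_lastStepKL`** — `T` a finite set of links of `l`, each `e ∈ T`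
  the last link of a plaquette `P e ∋ e`, with the divergence floor `m` at `e` against every off-`P e`
  context it does not read: `#T·m ≤ KL(F/Z ‖ H_l)`.
* §2 **`wilson_kl_arHybrid_ge_dim_mul_card_site_mul_of_stepKL`** (`d ≥ 2`, `l` lists ALL links, the floor
  at every link of every plaquette): `(d·#sites/4)·m ≤ KL`.
* §3 **`wilson_tauInt_sign_ge_exp_of_stepKL`**, **`wilson_invKish_ge_exp_of_stepKL`** —
  `exp((d·#sites/4)·m) − ½ ≤ τ_int(g)` for every measurable balanced sign observable `g`, `exp(…) ≤ 1/κ`.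

NOT CLAIMED: the floors; smooth observables; the reverse relative entropy.  No `def`, no `sorry`, nothing
cited as a fact beyond the tree.
-/

noncomputable section

namespace Summit.Ventures.LatticeQCDFlow.Theory2.Autoregressive

open MeasureTheory Function Set
open Literature.MathematicalPhysics.QuantumFieldTheory Literature.MathematicalPhysics.QuantumLattice
open Summit.Ventures.LatticeQCDFlow.Exactness Summit.Ventures.LatticeQCDFlow.Scoring
open scoped Matrix Matrix.Norms.Frobenius

section Wilson

variable {d L N : ℕ} {G : Type*} [Group G] [TopologicalSpace G] [IsTopologicalGroup G]
  [CompactSpace G] [SecondCountableTopology G] [MeasurableSpace G] [BorelSpace G] [NeZero L]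
  (ρ : G →* Matrix (Fin N) (Fin N) ℂ)

/-! ## §1 The loss floor indexed by links -/

/-- **The loss floor, link-indexed, from a per-link divergence floor.**  Continuous `ρ`, any `β`; an
autoregressive block `l` (duplicate-free, squeezed normalised conditionals not reading later links); a
finite set `T` of links of `l`, each `e ∈ T` the last link of a plaquette `P e ∋ e` (all other links of
`P e` come EARLIER in `l`); `m ≥ 0` with `m·Z ≤ ∫ F·log(A_sF/(q_e·A_{insert e s}F)) dπ` for every `e ∈ T` and every set `s` of
links off `P e` that `q_e` does not read.  Then `#T·m ≤ KL(F/Z ‖ H_l)`. [ours] -/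
theorem wilson_kl_arHybrid_ge_card_mul_of_lastStepKL (hρ : Continuous ρ) (β : ℝ)
    {q : Edge d L → GaugeConfig d L G → ℝ} (hqm : ∀ a, Measurable (q a)) {cq Cq : ℝ} (hcq : 0 < cq)
    (hqlo : ∀ a U, cq ≤ q a U) (hqhi : ∀ a U, q a U ≤ Cq)
    (hq1 : ∀ a U, ∫ v, q a (update U a v) ∂(haarProbability G) = 1)
    (l : List (Edge d L)) (hl : l.Nodup)
    (hpw : l.Pairwise (fun a b => ∀ (U : GaugeConfig d L G) (v : G), q a (update U b v) = q a U))
    (T : Finset (Edge d L)) (hT : ∀ e ∈ T, e ∈ l)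
    (P : Edge d L → Plaquette d L)
    (hbefore : ∀ e ∈ T, ∀ e' ∈ ({((P e).1, (P e).2.1.1), ((P e).1.shift (P e).2.1.1, (P e).2.1.2),
        ((P e).1.shift (P e).2.1.2, (P e).2.1.1), ((P e).1, (P e).2.1.2)} : Finset (Edge d L)),
        e' ≠ e → l.idxOf e' < l.idxOf e)
    {m : ℝ} (hm0 : 0 ≤ m)
    (hm : ∀ e ∈ T, ∀ s : Finset (Edge d L), s ⊆ Finset.univ \
        {((P e).1, (P e).2.1.1), ((P e).1.shift (P e).2.1.1, (P e).2.1.2),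
          ((P e).1.shift (P e).2.1.2, (P e).2.1.1), ((P e).1, (P e).2.1.2)} →
      (∀ U V : GaugeConfig d L G, q e (s.piecewise V U) = q e U) →
      m * (∫ W, Real.exp (-β * wilsonAction ρ W) ∂Measure.pi (fun _ : Edge d L => haarProbability G)) ≤
        ∫ U, Real.exp (-β * wilsonAction ρ U) *
            Real.log (coordAvg (haarProbability G) s (fun V : GaugeConfig d L G => Real.exp (-β * wilsonAction ρ V)) U /
              (q e U * coordAvg (haarProbability G) (insert e s)
                (fun V : GaugeConfig d L G => Real.exp (-β * wilsonAction ρ V)) U))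
          ∂Measure.pi (fun _ : Edge d L => haarProbability G)) :
    (T.card : ℝ) * m ≤
      ∫ U, Real.exp (-β * wilsonAction ρ U) /
            (∫ W, Real.exp (-β * wilsonAction ρ W) ∂Measure.pi (fun _ : Edge d L => haarProbability G)) *
          Real.log ((Real.exp (-β * wilsonAction ρ U) /
              ∫ W, Real.exp (-β * wilsonAction ρ W) ∂Measure.pi (fun _ : Edge d L => haarProbability G)) /
            ((l.map fun b => q b U).prod *
                coordAvg (haarProbability G) l.toFinset
                  (fun V : GaugeConfig d L G => Real.exp (-β * wilsonAction ρ V)) U /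
              ∫ W, Real.exp (-β * wilsonAction ρ W) ∂Measure.pi (fun _ : Edge d L => haarProbability G)))
        ∂Measure.pi (fun _ : Edge d L => haarProbability G) := by
  classical
  obtain ⟨hFm, B, hFlo, hFhi⟩ := wilsonWeight_props (d := d) (L := L) ρ hρ β
  have hidx := pairwise_idxOf_lt_of_nodup' hl
  have hZpos : 0 < ∫ W, Real.exp (-β * wilsonAction ρ W) ∂Measure.pi (fun _ : Edge d L => haarProbability G) :=
    integral_exp_pos (Literature.Probability.LatticeModels.integrable_of_continuous_compactSpace _
      (Real.continuous_exp.comp (continuous_const.mul (continuous_wilsonAction ρ hρ))))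
  refine kl_arHybrid_ge_card_mul_of_stepKL (haarProbability G) hqm hcq hqlo hqhi hq1 hFm
    (Real.exp_pos _) hFlo hFhi l hpw T hT hm0 (fun c hc hcT => ?_)
  -- the context of the step generating `c.1 ∈ T` lies off the plaquette `P c.1`
  have hsub : c.2.toFinset ⊆ Finset.univ \
      {((P c.1).1, (P c.1).2.1.1), ((P c.1).1.shift (P c.1).2.1.1, (P c.1).2.1.2),
        ((P c.1).1.shift (P c.1).2.1.2, (P c.1).2.1.1), ((P c.1).1, (P c.1).2.1.2)} := by
    intro b hb
    rw [Finset.mem_sdiff]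
    refine ⟨Finset.mem_univ _, fun hbl => ?_⟩
    have hb' : b ∈ c.2 := List.mem_toFinset.1 hb
    have hlt : l.idxOf c.1 < l.idxOf b := rel_of_mem_zip_tails l hidx c hc b hb'
    by_cases hbc : b = c.1
    · rw [hbc] at hlt; exact lt_irrefl _ hlt
    · exact lt_asymm hlt (hbefore c.1 hcT b hbl hbc)
  have hqs : ∀ U V : GaugeConfig d L G, q c.1 (c.2.toFinset.piecewise V U) = q c.1 U :=
    blind_piecewise_of_forall_update c.2 (rel_of_mem_zip_tails l hpw c hc)
  have h := hm c.1 hcT c.2.toFinset hsub hqs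
  rw [List.toFinset_cons]
  -- normalise by `Z`: `m ≤ (1/Z)·∫ F log(…) = ∫ (F/Z) log(…)`
  have e1 : ∫ U, Real.exp (-β * wilsonAction ρ U) /
        (∫ W, Real.exp (-β * wilsonAction ρ W) ∂Measure.pi (fun _ : Edge d L => haarProbability G)) *
        Real.log (coordAvg (haarProbability G) c.2.toFinset
          (fun V : GaugeConfig d L G => Real.exp (-β * wilsonAction ρ V)) U /
          (q c.1 U * coordAvg (haarProbability G) (insert c.1 c.2.toFinset)
            (fun V : GaugeConfig d L G => Real.exp (-β * wilsonAction ρ V)) U))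
        ∂Measure.pi (fun _ : Edge d L => haarProbability G) =
      (∫ U, Real.exp (-β * wilsonAction ρ U) *
        Real.log (coordAvg (haarProbability G) c.2.toFinset
          (fun V : GaugeConfig d L G => Real.exp (-β * wilsonAction ρ V)) U /
          (q c.1 U * coordAvg (haarProbability G) (insert c.1 c.2.toFinset)
            (fun V : GaugeConfig d L G => Real.exp (-β * wilsonAction ρ V)) U))
        ∂Measure.pi (fun _ : Edge d L => haarProbability G)) /
        (∫ W, Real.exp (-β * wilsonAction ρ W) ∂Measure.pi (fun _ : Edge d L => haarProbability G)) := by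
    rw [← integral_div]
    refine integral_congr_ae (ae_of_all _ fun U => ?_)
    ring
  rw [e1, le_div_iff₀ hZpos]
  exact h

/-! ## §2 The volume law -/

/-- **THE VOLUME LAW FOR THE TRAINING LOSS FROM A PER-LINK DIVERGENCE FLOOR.**  `d ≥ 2`; continuous `ρ`, any `β`;
squeezed normalised conditionals `q`; `l` a duplicate-free list of ALL links (any generation order),
`q_a` not reading later links; `m ≥ 0` such that for every plaquette `p`, every link `e` of `p` and every
set `s` of links off `p` not read by `q_e`: `m·Z ≤ ∫ F·log(A_sF/(q_e·A_{insert e s}F)) dπ`.  Then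
`(d·#sites/4)·m ≤ KL(e^{−βS_W}/Z ‖ H_l)`. [ours] -/
theorem wilson_kl_arHybrid_ge_dim_mul_card_site_mul_of_stepKL (hd : 2 ≤ d)
    (hρ : Continuous ρ) (β : ℝ)
    {q : Edge d L → GaugeConfig d L G → ℝ} (hqm : ∀ a, Measurable (q a)) {cq Cq : ℝ} (hcq : 0 < cq)
    (hqlo : ∀ a U, cq ≤ q a U) (hqhi : ∀ a U, q a U ≤ Cq)
    (hq1 : ∀ a U, ∫ v, q a (update U a v) ∂(haarProbability G) = 1)
    (l : List (Edge d L)) (hl : l.Nodup) (hall : ∀ e : Edge d L, e ∈ l)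
    (hpw : l.Pairwise (fun a b => ∀ (U : GaugeConfig d L G) (v : G), q a (update U b v) = q a U))
    {m : ℝ} (hm0 : 0 ≤ m)
    (hm : ∀ (p : Plaquette d L) (e : Edge d L), e ∈ ({(p.1, p.2.1.1), (p.1.shift p.2.1.1, p.2.1.2),
        (p.1.shift p.2.1.2, p.2.1.1), (p.1, p.2.1.2)} : Finset (Edge d L)) →
      ∀ s : Finset (Edge d L), s ⊆ Finset.univ \
        {(p.1, p.2.1.1), (p.1.shift p.2.1.1, p.2.1.2), (p.1.shift p.2.1.2, p.2.1.1), (p.1, p.2.1.2)} →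
      (∀ U V : GaugeConfig d L G, q e (s.piecewise V U) = q e U) →
      m * (∫ W, Real.exp (-β * wilsonAction ρ W) ∂Measure.pi (fun _ : Edge d L => haarProbability G)) ≤
        ∫ U, Real.exp (-β * wilsonAction ρ U) *
            Real.log (coordAvg (haarProbability G) s (fun V : GaugeConfig d L G => Real.exp (-β * wilsonAction ρ V)) U /
              (q e U * coordAvg (haarProbability G) (insert e s)
                (fun V : GaugeConfig d L G => Real.exp (-β * wilsonAction ρ V)) U))
          ∂Measure.pi (fun _ : Edge d L => haarProbability G)) :
    (d : ℝ) * Fintype.card (Site d L) / 4 * m ≤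
      ∫ U, Real.exp (-β * wilsonAction ρ U) /
            (∫ W, Real.exp (-β * wilsonAction ρ W) ∂Measure.pi (fun _ : Edge d L => haarProbability G)) *
          Real.log ((Real.exp (-β * wilsonAction ρ U) /
              ∫ W, Real.exp (-β * wilsonAction ρ W) ∂Measure.pi (fun _ : Edge d L => haarProbability G)) /
            ((l.map fun b => q b U).prod *
                coordAvg (haarProbability G) l.toFinset
                  (fun V : GaugeConfig d L G => Real.exp (-β * wilsonAction ρ V)) U /
              ∫ W, Real.exp (-β * wilsonAction ρ W) ∂Measure.pi (fun _ : Edge d L => haarProbability G)))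
        ∂Measure.pi (fun _ : Edge d L => haarProbability G) := by
  classical
  -- the last links of ALL plaquettes
  obtain ⟨T, P, hP, hbefore, hcount⟩ := exists_lastLinks_all (L := L) hd l hall
  have hfloor := wilson_kl_arHybrid_ge_card_mul_of_lastStepKL (d := d) (L := L) ρ hρ β hqm hcq hqlo hqhi
    hq1 l hl hpw T (fun e _ => hall e) P hbefore hm0 (fun e he s hs hqs => hm (P e) e (hP e he) s hs hqs)
  -- `#sites·d ≤ 4·#T`
  have hnat : Fintype.card (Site d L) * d ≤ 4 * T.card := by
    have h2 := two_mul_card_plaquette d L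
    have hd1 : 0 < d - 1 := by omega
    refine Nat.le_of_mul_le_mul_right ?_ hd1
    calc Fintype.card (Site d L) * d * (d - 1) = 2 * Fintype.card (Plaquette d L) := by rw [h2]; ring
      _ ≤ 2 * (2 * (d - 1) * T.card) := Nat.mul_le_mul_left 2 hcount
      _ = 4 * T.card * (d - 1) := by ring
  have hcard : (d : ℝ) * Fintype.card (Site d L) / 4 ≤ (T.card : ℝ) := by
    rw [div_le_iff₀ (by norm_num : (0 : ℝ) < 4)]
    have : ((Fintype.card (Site d L) * d : ℕ) : ℝ) ≤ ((4 * T.card : ℕ) : ℝ) := by exact_mod_cast hnat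
    push_cast at this
    linarith
  calc (d : ℝ) * Fintype.card (Site d L) / 4 * m
      ≤ (T.card : ℝ) * m := mul_le_mul_of_nonneg_right hcard hm0
    _ ≤ _ := hfloor

/-! ## §3 Exponential slowing down in the volume -/

/-- **`τ_int(g) ≥ exp((d·#sites/4)·m) − ½`** for every measurable balanced sign observable `g` of the
exact independence sampler with target `e^{−βS_W}/Z` and the autoregressive proposal, under the
hypotheses of `wilson_kl_arHybrid_ge_dim_mul_card_site_mul_of_stepKL`. [ours] -/
theorem wilson_tauInt_sign_ge_exp_of_stepKL (hd : 2 ≤ d) (hρ : Continuous ρ) (β : ℝ)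
    {q : Edge d L → GaugeConfig d L G → ℝ} (hqm : ∀ a, Measurable (q a)) {cq Cq : ℝ} (hcq : 0 < cq)
    (hqlo : ∀ a U, cq ≤ q a U) (hqhi : ∀ a U, q a U ≤ Cq)
    (hq1 : ∀ a U, ∫ v, q a (update U a v) ∂(haarProbability G) = 1)
    (l : List (Edge d L)) (hl : l.Nodup) (hall : ∀ e : Edge d L, e ∈ l)
    (hpw : l.Pairwise (fun a b => ∀ (U : GaugeConfig d L G) (v : G), q a (update U b v) = q a U))
    {m : ℝ} (hm0 : 0 ≤ m)
    (hm : ∀ (p : Plaquette d L) (e : Edge d L), e ∈ ({(p.1, p.2.1.1), (p.1.shift p.2.1.1, p.2.1.2),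
        (p.1.shift p.2.1.2, p.2.1.1), (p.1, p.2.1.2)} : Finset (Edge d L)) →
      ∀ s : Finset (Edge d L), s ⊆ Finset.univ \
        {(p.1, p.2.1.1), (p.1.shift p.2.1.1, p.2.1.2), (p.1.shift p.2.1.2, p.2.1.1), (p.1, p.2.1.2)} →
      (∀ U V : GaugeConfig d L G, q e (s.piecewise V U) = q e U) →
      m * (∫ W, Real.exp (-β * wilsonAction ρ W) ∂Measure.pi (fun _ : Edge d L => haarProbability G)) ≤
        ∫ U, Real.exp (-β * wilsonAction ρ U) *
            Real.log (coordAvg (haarProbability G) s (fun V : GaugeConfig d L G => Real.exp (-β * wilsonAction ρ V)) U /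
              (q e U * coordAvg (haarProbability G) (insert e s)
                (fun V : GaugeConfig d L G => Real.exp (-β * wilsonAction ρ V)) U))
          ∂Measure.pi (fun _ : Edge d L => haarProbability G))
    {g : GaugeConfig d L G → ℝ} (hgm : Measurable g) (hg1 : ∀ U, g U ^ 2 = 1)
    (hg0 : ∫ U, g U * Real.exp (-β * wilsonAction ρ U) ∂Measure.pi (fun _ : Edge d L => haarProbability G) = 0) :
    Real.exp ((d : ℝ) * Fintype.card (Site d L) / 4 * m) - 1 / 2 ≤
      tauInt (fun k => (∫ U, g U * ((imhOp (Measure.pi fun _ : Edge d L => haarProbability G)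
          (fun V : GaugeConfig d L G => Real.exp (-β * wilsonAction ρ V))
          (fun V : GaugeConfig d L G => (l.map fun b => q b V).prod *
              coordAvg (haarProbability G) l.toFinset
                (fun V' : GaugeConfig d L G => Real.exp (-β * wilsonAction ρ V')) V /
            ∫ W, Real.exp (-β * wilsonAction ρ W) ∂Measure.pi (fun _ : Edge d L => haarProbability G)))^[k]
            g) U * Real.exp (-β * wilsonAction ρ U) ∂Measure.pi (fun _ : Edge d L => haarProbability G)) /
          ∫ U, g U ^ 2 * Real.exp (-β * wilsonAction ρ U) ∂Measure.pi (fun _ : Edge d L => haarProbability G)) := by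
  obtain ⟨hFm, B, hFlo, hFhi⟩ := wilsonWeight_props (d := d) (L := L) ρ hρ β
  have hkl := wilson_kl_arHybrid_ge_dim_mul_card_site_mul_of_stepKL (d := d) (L := L) ρ hd hρ
    β hqm hcq hqlo hqhi hq1 l hl hall hpw hm0 hm
  have htau := arHybrid_exp_kl_le_tauInt_sign (haarProbability G) hqm hcq hqlo hqhi hq1 hFm
    (Real.exp_pos _) hFlo hFhi l hpw hgm hg1 hg0
  exact le_trans (sub_le_sub_right (Real.exp_le_exp.2 hkl) _) htau

/-- **`1/κ ≥ exp((d·#sites/4)·m)`** — the Kish effective-sample-size fraction of the reweighting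
estimator built on such a model is at most `exp(−(d·#sites/4)·m)`. [ours] -/
theorem wilson_invKish_ge_exp_of_stepKL (hd : 2 ≤ d) (hρ : Continuous ρ) (β : ℝ)
    {q : Edge d L → GaugeConfig d L G → ℝ} (hqm : ∀ a, Measurable (q a)) {cq Cq : ℝ} (hcq : 0 < cq)
    (hqlo : ∀ a U, cq ≤ q a U) (hqhi : ∀ a U, q a U ≤ Cq)
    (hq1 : ∀ a U, ∫ v, q a (update U a v) ∂(haarProbability G) = 1)
    (l : List (Edge d L)) (hl : l.Nodup) (hall : ∀ e : Edge d L, e ∈ l)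
    (hpw : l.Pairwise (fun a b => ∀ (U : GaugeConfig d L G) (v : G), q a (update U b v) = q a U))
    {m : ℝ} (hm0 : 0 ≤ m)
    (hm : ∀ (p : Plaquette d L) (e : Edge d L), e ∈ ({(p.1, p.2.1.1), (p.1.shift p.2.1.1, p.2.1.2),
        (p.1.shift p.2.1.2, p.2.1.1), (p.1, p.2.1.2)} : Finset (Edge d L)) →
      ∀ s : Finset (Edge d L), s ⊆ Finset.univ \
        {(p.1, p.2.1.1), (p.1.shift p.2.1.1, p.2.1.2), (p.1.shift p.2.1.2, p.2.1.1), (p.1, p.2.1.2)} →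
      (∀ U V : GaugeConfig d L G, q e (s.piecewise V U) = q e U) →
      m * (∫ W, Real.exp (-β * wilsonAction ρ W) ∂Measure.pi (fun _ : Edge d L => haarProbability G)) ≤
        ∫ U, Real.exp (-β * wilsonAction ρ U) *
            Real.log (coordAvg (haarProbability G) s (fun V : GaugeConfig d L G => Real.exp (-β * wilsonAction ρ V)) U /
              (q e U * coordAvg (haarProbability G) (insert e s)
                (fun V : GaugeConfig d L G => Real.exp (-β * wilsonAction ρ V)) U))
          ∂Measure.pi (fun _ : Edge d L => haarProbability G)) :
    Real.exp ((d : ℝ) * Fintype.card (Site d L) / 4 * m) ≤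
      (∫ U, Real.exp (-β * wilsonAction ρ U) /
            ((l.map fun b => q b U).prod *
                coordAvg (haarProbability G) l.toFinset
                  (fun V : GaugeConfig d L G => Real.exp (-β * wilsonAction ρ V)) U /
              ∫ W, Real.exp (-β * wilsonAction ρ W) ∂Measure.pi (fun _ : Edge d L => haarProbability G)) *
          Real.exp (-β * wilsonAction ρ U) ∂Measure.pi (fun _ : Edge d L => haarProbability G)) /
        (∫ W, Real.exp (-β * wilsonAction ρ W) ∂Measure.pi (fun _ : Edge d L => haarProbability G)) ^ 2 := by
  obtain ⟨hFm, B, hFlo, hFhi⟩ := wilsonWeight_props (d := d) (L := L) ρ hρ β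
  have hkl := wilson_kl_arHybrid_ge_dim_mul_card_site_mul_of_stepKL (d := d) (L := L) ρ hd hρ
    β hqm hcq hqlo hqhi hq1 l hl hall hpw hm0 hm
  exact (Real.exp_le_exp.2 hkl).trans (arHybrid_exp_kl_le_invKish (haarProbability G) hqm hcq hqlo hqhi hq1
    hFm (Real.exp_pos _) hFlo hFhi l hpw)

end Wilson

end Summit.Ventures.LatticeQCDFlow.Theory2.Autoregressive

end
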